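import Literature.NumberTheory.Automorphic.AutomorphicTwistBJ
import Literature.NumberTheory.Automorphic.NewformAdelisationHeckeCosets
import Literature.NumberTheory.Automorphic.UnramifiedHeckeLevel
import Mathlib.NumberTheory.DirichletCharacter.Orthogonality
import HarnessLib

/-!
# A new vector up to twist for automorphic representations of `GL₂(𝔸_ℚ)`

Topic `NumberTheory/Automorphic`; definitions and theorems, everything proved, no named fact.
This file removes the "existence of the new vector" hypothesis (Casselman, *On some results of Atkin
and Lehner*, Math. Ann. 201 (1973), Thm. 1: an irreducible admissible generic `π_p` has a non-zero
vector fixed by `K₁(p^{c(π_p)})`) from the bottom-up weight-one dictionary `π ↦ f_π` of the tree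
(`StrongArtinGL2WeightOneDescent`, support of Gelbart 1997, Prop. 2.5 / Prop. 4.2 =
`exists_isNewform1_of_isPiOfArtinRep` of `StrongArtinGL2`), by an **elementary substitute valid up
to twist**:

* `AutomorphicRepData.exists_twist_mem_gammaOneFiniteInvariants` — for an automorphic
  representation `π = W / W'` of `GL₂(𝔸_ℚ)` (Borel–Jacquet datum) and a non-zero `K(M)`-fixed
  `ψ ∈ W`, there is a Dirichlet character `χ` mod `M` such that the twist `π ⊗ (χ̃ ∘ det)`
  (`AutomorphicRepData.twist`, `χ̃ = HeckeCharacter.ofDirichlet χ`) contains a **non-zero form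
  right invariant under `{1} × K₁(M²)`** (`gammaOneFiniteInvariants (M^2)`);
* `AutomorphicRepData.exists_level_twist_mem_gammaOneFiniteInvariants` — the same for every `π`,
  with `M = N(𝔫)` for a level `K(𝔫)` of a form of `π` (`exists_principalCongruenceLevel_fixed`).

## The argument (folklore; cf. Deligne, *Formes modulaires et représentations de GL(2)*, Antwerp II,
LNM 349 (1973), §3, and Gelbart 1975, §5.B, for the passage between `K(M)`- and `K₁`-type levels)

Let `h_M = diag(M⁻¹, 1) ∈ GL₂(𝔸_ℚ^∞)` (`Rat.levelRaisingElt`). For `u = (a b; c d) ∈ K₁(M²)` one has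
`h_M⁻¹ u h_M = (a, M b; c/M, d)`, which lies in `K(M)` as soon as `a ≡ 1 (mod M)`
(`Rat.ofFinite_conj_levelRaisingElt_mem`); and `a ≡ det u (mod M)` on `K₁(M²)`
(`Rat.entry_sub_one_mem_levelIdeal_of_det`). Hence the translate `ψ₁ = r(h_M) ψ` of a `K(M)`-fixed
form is fixed by the kernel of the homomorphism `r : K₁(M²) → (ℤ/M)ˣ`, `u ↦ [det (1, u)]`
(`detRayClass`, the tree's ray class map `Rat.rayClassHom` of `HeckeCharacterProofs`; the passage
from `[det u] = 1` back to the congruence `det u ≡ 1 (mod M ẑ)` is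
`Rat.sub_one_mem_levelIdeal_of_redMod_eq_one`, Mathlib `PadicInt.ker_toZModPow`). Finite Fourier
analysis on `(ℤ/M)ˣ` (`charComponent`, `apply_charComponent`, `sum_charComponent`: for a linear
action through `r` of a vector fixed by `ker r`, `v = φ(M)⁻¹ ∑_χ v_χ` with `ρ(u) v_χ = χ(r u) v_χ`)
gives a non-zero component `ψ_χ ∈ W` with `r(u) ψ_χ = χ([det u]) ψ_χ` for `u ∈ K₁(M²)`; since
`χ̃(det (1, u)) = χ([det u])⁻¹` (`HeckeCharacter.ofDirichlet_apply`), the form `(χ̃ ∘ det) · ψ_χ` of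
`π ⊗ (χ̃ ∘ det)` is `K₁(M²)`-invariant (`rightTranslation_mulChar`).

(The genuine new vector — `χ = 1` — needs the Kirillov model; it is not claimed.)

## Contents

* Ideles of `ℚ`: `Rat.valued_sub_one_le_of_localRed_eq_one`, `Rat.localRed_eq_one_of_redMod_eq_one`,
  `Rat.valuation_natCast_eq`, `Rat.idealRadius_span_natCast_eq`, `Rat.sub_one_mem_levelIdeal_of_redMod_eq_one`.
* Finite-adelic congruence arithmetic: `Rat.natUnitFinite M ∈ (𝔸_ℚ^∞)ˣ`, `Rat.levelIdeal_sq_le`,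
  `Rat.natUnitFinite_inv_mul_mem_levelIdeal`, `Rat.ofFinite_mem_principalCongruenceLevel` (entrywise
  criterion for `(1, g) ∈ K(𝔫)`), `Rat.levelRaisingElt`, `Rat.levelRaisingElt_conj_apply`,
  `Rat.ofFinite_conj_levelRaisingElt_mem`, `Rat.entry_sub_one_mem_levelIdeal_of_det`,
  `Rat.det_ofFinite_snd/fst`, `Rat.valued_det_ofFinite_eq_one`,
  `Rat.entry_sub_one_mem_levelIdeal_of_rayClassHom_eq_one`.
* `charComponent` and its three properties (any group, any linear action over `ℂ`).
* `gammaOneFiniteInvariants M` (functions on `GL₂(𝔸_ℚ)` right invariant under `{1} × K₁(M)`),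
  `gammaOneRep`, `detRayClass`, `gammaOneRep_rightTranslation_levelRaisingElt`, and the two main theorems.

## Mathlib / Literature search

`lean search 'Casselman|newvector|mirabolic'`: no new-vector theory in the tree (the mirabolic files
concern Eisenstein series). Reused: `AutomorphicTwistBJ` (`mulChar`, `detTwist`, `AutomorphicRepData.twist`,
`rightTranslation_mulChar`), `HeckeCharacterProofs` (`Rat.redMod`, `Rat.rayClassHom`,
`HeckeCharacter.ofDirichlet`), `StrongApproximationGL2` (`gammaOneFiniteLevel`, `levelIdeal`),
`GLnAdelicStructure(Proofs)` (`principalCongruenceLevel`, `GLn.ofFinite`), `AutomorphicRepsGLSatakeProofs`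
(`exists_principalCongruenceLevel_fixed`), `UnramifiedHeckeLevel` (`principalCongruenceLevel_mono`),
Mathlib `DirichletCharacter.sum_characters_eq`, `PadicInt.ker_toZModPow`, `Ideal.absNorm_mem`.
The determinant lemmas `det_ofFinite_snd/fst` also exist, for `GL_n`, in
`AshSmithTheoryHeckeNormCharacterProofs` (namespace `Ash2003`, cohomological import cone); the `n = 2`
versions are re-proved here (10 lines) to keep the adelisation chain free of that cone.

## References

* W. Casselman, *On some results of Atkin and Lehner*, Math. Ann. 201 (1973), 301–314, Thm. 1.
* P. Deligne, *Formes modulaires et représentations de GL(2)*, in Modular functions of one variable II,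
  LNM 349 (1973), §3.
* S. Gelbart, *Automorphic forms on adele groups*, Ann. of Math. Stud. 83 (1975), §3.A, §5.B [Gelbart1975].
* S. Gelbart, *Three lectures on the modularity of `ρ̄_{E,3}` and the Langlands reciprocity conjecture*,
  in Modular forms and Fermat's last theorem (1997), Prop. 2.5, Prop. 4.2 [Gelbart1997].
* J. Neukirch, *Algebraic Number Theory* (1999), Ch. VI §1, Prop. (1.9)–(1.10) [NeukirchANT1999].
-/

noncomputable section

open scoped MatrixGroups Matrix Classical
open NumberField IsDedekindDomain

namespace Literature.NumberTheory.Automorphic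

open GaloisRepresentations Rat.HeightOneSpectrum

/-! ### Ideles of `ℚ`: from the reduction mod `M` back to congruences -/

section IdeleCongruence

attribute [local instance] Rat.fact_prime_natGenerator

variable (v : HeightOneSpectrum (𝓞 ℚ))

/-- **Converse of `Rat.localRed_eq_one_of_valued_sub_one_le`**: if the unit part of `x_v` reduces to
`1` mod `p_v^k` and `x_v` is a unit, then `x_v ≡ 1 (mod p_v^k)` (Mathlib `PadicInt.ker_toZModPow`).
[folklore] -/
theorem Rat.valued_sub_one_le_of_localRed_eq_one (k : ℕ) {x : ideleGroup ℚ}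
    (h1 : Valued.v ((x : AdeleRing (𝓞 ℚ) ℚ).2 v) = 1) (h : Rat.localRed v k x = 1) :
    Valued.v ((x : AdeleRing (𝓞 ℚ) ℚ).2 v - 1) ≤ WithZero.exp (-(k : ℤ)) := by
  rw [Rat.valued_le_iff_norm_toPadic_le, map_sub, map_one]
  have hU : ((Rat.padicUnitPart v x : ℤ_[natGenerator v]) : ℚ_[natGenerator v]) =
      Rat.toPadic v ((x : AdeleRing (𝓞 ℚ) ℚ).2 v) := by
    rw [Rat.coe_padicUnitPart_of_valued_eq_one v x h1, Rat.padicComp_apply]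
  have hker : (Rat.padicUnitPart v x : ℤ_[natGenerator v]) - 1 ∈
      RingHom.ker (PadicInt.toZModPow k : ℤ_[natGenerator v] →+* ZMod (natGenerator v ^ k)) := by
    rw [RingHom.mem_ker, map_sub, map_one, ← Rat.val_localRed, h, Units.val_one, sub_self]
  rw [PadicInt.ker_toZModPow, ← PadicInt.norm_le_pow_iff_mem_span_pow, PadicInt.norm_def,
    PadicInt.coe_sub, PadicInt.coe_one, hU] at hker
  exact hker

/-- `redMod m x = 1` forces each local reduction at `q ∣ m` to be `1`. [folklore] -/
theorem Rat.localRed_eq_one_of_redMod_eq_one {m : ℕ} [NeZero m] {x : ideleGroup ℚ}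
    (h : Rat.redMod m x = 1) (q : m.primeFactors) :
    Rat.localRed (Rat.placeOfFactor m q) (m.factorization q) x = 1 := by
  have h1 := Rat.equivPi_redMod m x q
  rw [h, Units.val_one, map_one, Pi.one_apply, Rat.val_localRedFactor] at h1
  refine Units.ext ((ZMod.ringEquivCongr (Rat.natGenerator_placeOfFactor_pow m q)).injective ?_)
  rw [← h1, Units.val_one, map_one]

/-- `v(M) = p_v^{-ord_{p_v} M}` for a non-zero natural number `M`. [folklore] -/
theorem Rat.valuation_natCast_eq {M : ℕ} (hM : M ≠ 0) :
    v.valuation ℚ (M : ℚ) = WithZero.exp (-(M.factorization (natGenerator v) : ℤ)) := by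
  set p := natGenerator v with hp
  have hdecomp : p ^ M.factorization p * (M / p ^ M.factorization p) = M := Nat.ordProj_mul_ordCompl_eq_self M p
  have hcop : ¬ p ∣ M / p ^ M.factorization p := Nat.not_dvd_ordCompl (prime_natGenerator v) hM
  conv_lhs => rw [← hdecomp]
  rw [Nat.cast_mul, Nat.cast_pow, map_mul, map_pow, Rat.valuation_natGenerator,
    ← Int.cast_natCast (M / p ^ M.factorization p), Rat.valuation_intCast_eq_one v (by exact_mod_cast hcop),
    mul_one, ← WithZero.exp_nsmul, smul_neg, nsmul_eq_mul, mul_one]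

/-- The radius of the level ideal `(M)` at `v` is `p_v^{-ord_{p_v} M}`. [folklore] -/
theorem Rat.idealRadius_span_natCast_eq {M : ℕ} (hM : M ≠ 0) :
    idealRadius ℚ v (Ideal.span {(M : 𝓞 ℚ)}) = WithZero.exp (-(M.factorization (natGenerator v) : ℤ)) := by
  rw [Rat.idealRadius_span_natCast v hM, Rat.valuation_natCast_eq v hM]

/-- `|M|_v` in `ℚ_v` is the radius of the level ideal `(M)` at `v`. [folklore] -/
theorem Rat.valued_natCast_eq_idealRadius {M : ℕ} (hM : M ≠ 0) :
    Valued.v ((M : ℕ) : v.adicCompletion ℚ) = idealRadius ℚ v (Ideal.span {(M : 𝓞 ℚ)}) := by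
  rw [Rat.valued_natCast, Rat.idealRadius_span_natCast v hM]

/-- **From the ray class back to the congruence**: an idele `x` of `ℚ` all of whose finite
components are units and whose reduction mod `M` is trivial satisfies `x_f ≡ 1 (mod M ẑ)`, i.e.
`x_f - 1 ∈ M ẑ` (`levelIdeal`). [folklore] -/
theorem Rat.sub_one_mem_levelIdeal_of_redMod_eq_one {M : ℕ} [NeZero M] {x : ideleGroup ℚ}
    (hunit : ∀ v, Valued.v ((x : AdeleRing (𝓞 ℚ) ℚ).2 v) = 1) (h : Rat.redMod M x = 1) :
    (x : AdeleRing (𝓞 ℚ) ℚ).2 - 1 ∈ levelIdeal ℚ (Ideal.span {(M : 𝓞 ℚ)}) := by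
  rw [mem_levelIdeal_iff]
  intro v
  have e : ((x : AdeleRing (𝓞 ℚ) ℚ).2 - 1) v = (x : AdeleRing (𝓞 ℚ) ℚ).2 v - 1 := rfl
  rw [e]
  by_cases hv : natGenerator v ∣ M
  · obtain ⟨q, hq⟩ := Rat.exists_placeOfFactor_eq hv
    subst hq
    refine (Rat.valued_sub_one_le_of_localRed_eq_one _ _ (hunit _)
      (Rat.localRed_eq_one_of_redMod_eq_one h q)).trans (le_of_eq ?_)
    rw [Rat.idealRadius_span_natCast_eq _ (NeZero.ne M), Rat.natGenerator_placeOfFactor]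
  · rw [idealRadius_eq_one_of_not_dvd (Rat.span_natCast_ne_zero M) (mt (Rat.natGenerator_dvd_iff v M).2 hv)]
    refine (Valuation.map_sub _ _ _).trans (max_le (hunit v).le ?_)
    rw [map_one]

end IdeleCongruence

/-! ### Finite-adelic congruence arithmetic over `ℚ` -/

section FiniteLevel

/-- The finite-adelic unit of a non-zero natural number `M` (`M ∈ ℚˣ ⊆ (𝔸_ℚ^∞)ˣ`). [folklore] -/
def Rat.natUnitFinite (M : ℕ) [NeZero M] : (FiniteAdeleRing (𝓞 ℚ) ℚ)ˣ :=
  Units.map (algebraMap ℚ (FiniteAdeleRing (𝓞 ℚ) ℚ) : ℚ →* FiniteAdeleRing (𝓞 ℚ) ℚ)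
    (Units.mk0 (M : ℚ) (by exact_mod_cast NeZero.ne M))

variable {M : ℕ} [NeZero M]

/-- Unfolding `Rat.natUnitFinite`. [folklore] -/
theorem Rat.coe_natUnitFinite :
    (Rat.natUnitFinite M : FiniteAdeleRing (𝓞 ℚ) ℚ) = algebraMap ℚ (FiniteAdeleRing (𝓞 ℚ) ℚ) (M : ℚ) := rfl

/-- `|M|_v` is the radius of the level ideal `(M)` at `v`. [folklore] -/
theorem Rat.valued_natUnitFinite (v : HeightOneSpectrum (𝓞 ℚ)) :
    Valued.v ((Rat.natUnitFinite M : FiniteAdeleRing (𝓞 ℚ) ℚ) v) = idealRadius ℚ v (Ideal.span {(M : 𝓞 ℚ)}) := by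
  rw [Rat.coe_natUnitFinite, FiniteAdeleRing.algebraMap_apply, HeightOneSpectrum.valuedAdicCompletion_eq_valuation',
    Rat.idealRadius_span_natCast v (NeZero.ne M)]

omit [NeZero M] in
/-- The radius of `(M)` is non-zero. [folklore] -/
theorem Rat.idealRadius_span_natCast_ne_zero (v : HeightOneSpectrum (𝓞 ℚ)) :
    idealRadius ℚ v (Ideal.span {(M : 𝓞 ℚ)}) ≠ 0 := by
  rw [idealRadius]; exact WithZero.exp_ne_zero

/-- `|M⁻¹|_v = |M|_v⁻¹`. [folklore] -/
theorem Rat.valued_natUnitFinite_inv (v : HeightOneSpectrum (𝓞 ℚ)) :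
    Valued.v (((((Rat.natUnitFinite M)⁻¹ : (FiniteAdeleRing (𝓞 ℚ) ℚ)ˣ) : FiniteAdeleRing (𝓞 ℚ) ℚ) v)) =
      (idealRadius ℚ v (Ideal.span {(M : 𝓞 ℚ)}))⁻¹ := by
  have h : ((((Rat.natUnitFinite M)⁻¹ : (FiniteAdeleRing (𝓞 ℚ) ℚ)ˣ) : FiniteAdeleRing (𝓞 ℚ) ℚ) v) *
      ((Rat.natUnitFinite M : FiniteAdeleRing (𝓞 ℚ) ℚ) v) = 1 := by
    rw [← FiniteAdeleRing.mul_apply', Units.inv_mul]; rfl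
  have h' := congrArg Valued.v h
  rw [map_mul, map_one, Rat.valued_natUnitFinite] at h'
  exact eq_inv_of_mul_eq_one_left h'

/-- `M ∈ M ẑ`. [folklore] -/
theorem Rat.natUnitFinite_mem_levelIdeal :
    (Rat.natUnitFinite M : FiniteAdeleRing (𝓞 ℚ) ℚ) ∈ levelIdeal ℚ (Ideal.span {(M : 𝓞 ℚ)}) := by
  rw [mem_levelIdeal_iff]; intro v; rw [Rat.valued_natUnitFinite]

/-- `M ∈ ẑ`. [folklore] -/
theorem Rat.natUnitFinite_mem_integralFiniteAdeles :
    (Rat.natUnitFinite M : FiniteAdeleRing (𝓞 ℚ) ℚ) ∈ integralFiniteAdeles ℚ :=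
  mem_integralFiniteAdeles_of_mem_levelIdeal Rat.natUnitFinite_mem_levelIdeal

/-- The radius of `(M²)` is the square of the radius of `(M)`. [folklore] -/
theorem Rat.idealRadius_span_natCast_sq (v : HeightOneSpectrum (𝓞 ℚ)) :
    idealRadius ℚ v (Ideal.span {((M ^ 2 : ℕ) : 𝓞 ℚ)}) = (idealRadius ℚ v (Ideal.span {(M : 𝓞 ℚ)})) ^ 2 := by
  rw [Rat.idealRadius_span_natCast v (pow_ne_zero 2 (NeZero.ne M)), Rat.idealRadius_span_natCast v (NeZero.ne M),
    Nat.cast_pow, map_pow]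

/-- `M² ẑ ⊆ M ẑ`. [folklore] -/
theorem Rat.levelIdeal_sq_le :
    levelIdeal ℚ (Ideal.span {((M ^ 2 : ℕ) : 𝓞 ℚ)}) ≤ levelIdeal ℚ (Ideal.span {(M : 𝓞 ℚ)}) := by
  intro x hx
  rw [mem_levelIdeal_iff] at hx ⊢
  intro v
  refine (hx v).trans ?_
  rw [Rat.idealRadius_span_natCast_sq, sq]
  exact mul_le_of_le_one_left' (idealRadius_le_one' v _)

/-- `M⁻¹ c ∈ M ẑ` for `c ∈ M² ẑ`. [folklore] -/
theorem Rat.natUnitFinite_inv_mul_mem_levelIdeal {c : FiniteAdeleRing (𝓞 ℚ) ℚ}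
    (hc : c ∈ levelIdeal ℚ (Ideal.span {((M ^ 2 : ℕ) : 𝓞 ℚ)})) :
    (((Rat.natUnitFinite M)⁻¹ : (FiniteAdeleRing (𝓞 ℚ) ℚ)ˣ) : FiniteAdeleRing (𝓞 ℚ) ℚ) * c ∈
      levelIdeal ℚ (Ideal.span {(M : 𝓞 ℚ)}) := by
  rw [mem_levelIdeal_iff] at hc ⊢
  intro v
  rw [FiniteAdeleRing.mul_apply', map_mul, Rat.valued_natUnitFinite_inv]
  have h0 := Rat.idealRadius_span_natCast_ne_zero (M := M) v
  calc (idealRadius ℚ v (Ideal.span {(M : 𝓞 ℚ)}))⁻¹ * Valued.v (c v)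
      ≤ (idealRadius ℚ v (Ideal.span {(M : 𝓞 ℚ)}))⁻¹ * idealRadius ℚ v (Ideal.span {((M ^ 2 : ℕ) : 𝓞 ℚ)}) :=
        mul_le_mul' le_rfl (hc v)
    _ = idealRadius ℚ v (Ideal.span {(M : 𝓞 ℚ)}) := by
        rw [Rat.idealRadius_span_natCast_sq, sq, ← mul_assoc, inv_mul_cancel₀ h0, one_mul]

/-- `c M⁻¹ ∈ M ẑ` for `c ∈ M² ẑ`. [folklore] -/
theorem Rat.mul_natUnitFinite_inv_mem_levelIdeal {c : FiniteAdeleRing (𝓞 ℚ) ℚ}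
    (hc : c ∈ levelIdeal ℚ (Ideal.span {((M ^ 2 : ℕ) : 𝓞 ℚ)})) :
    c * (((Rat.natUnitFinite M)⁻¹ : (FiniteAdeleRing (𝓞 ℚ) ℚ)ˣ) : FiniteAdeleRing (𝓞 ℚ) ℚ) ∈
      levelIdeal ℚ (Ideal.span {(M : 𝓞 ℚ)}) := by
  rw [mul_comm]; exact Rat.natUnitFinite_inv_mul_mem_levelIdeal hc

/-- **`K(𝔫)`-membership of a finite-adelic matrix, entrywise**: `(1, g) ∈ K(𝔫)` if the entries of
`g` and `g⁻¹` are integral and `g ≡ 1 (mod 𝔫 ẑ)` entrywise. [folklore] -/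
theorem Rat.ofFinite_mem_principalCongruenceLevel {𝔫 : Ideal (𝓞 ℚ)} {g : GL (Fin 2) (FiniteAdeleRing (𝓞 ℚ) ℚ)}
    (hint : ∀ i j, (g : Matrix (Fin 2) (Fin 2) (FiniteAdeleRing (𝓞 ℚ) ℚ)) i j ∈ integralFiniteAdeles ℚ)
    (hint' : ∀ i j, ((g⁻¹ : GL (Fin 2) (FiniteAdeleRing (𝓞 ℚ) ℚ)) : Matrix (Fin 2) (Fin 2) (FiniteAdeleRing (𝓞 ℚ) ℚ)) i j ∈
      integralFiniteAdeles ℚ)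
    (hcong : ∀ i j, (g : Matrix (Fin 2) (Fin 2) (FiniteAdeleRing (𝓞 ℚ) ℚ)) i j -
      (1 : Matrix (Fin 2) (Fin 2) (FiniteAdeleRing (𝓞 ℚ) ℚ)) i j ∈ levelIdeal ℚ 𝔫) :
    GLn.ofFinite 2 ℚ g ∈ principalCongruenceLevel 2 ℚ 𝔫 := by
  rw [mem_principalCongruenceLevel_iff]
  refine ⟨GLn.ofFinite_mem_glIntegralLevel (mem_glFiniteIntegralLevel_iff.2 ⟨hint, hint'⟩), fun v => ?_⟩
  change Matrix.GeneralLinearGroup.map (AdelicGroupData.adeleEval ℚ v) (GLn.ofFinite 2 ℚ g) ∈ _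
  rw [mem_valuedCongruenceSubgroup_iff]
  have e1 : ∀ i j, (((Matrix.GeneralLinearGroup.map (AdelicGroupData.adeleEval ℚ v) (GLn.ofFinite 2 ℚ g) :
      GL (Fin 2) (v.adicCompletion ℚ)) : Matrix (Fin 2) (Fin 2) (v.adicCompletion ℚ)) i j) =
      ((g : Matrix (Fin 2) (Fin 2) (FiniteAdeleRing (𝓞 ℚ) ℚ)) i j) v := by
    intro i j
    rw [AdelicGroupData.coe_map_adeleEval_apply, GLn.coe_ofFinite_apply]
    rfl
  have e2 : ∀ i j, ((((Matrix.GeneralLinearGroup.map (AdelicGroupData.adeleEval ℚ v) (GLn.ofFinite 2 ℚ g))⁻¹ :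
      GL (Fin 2) (v.adicCompletion ℚ)) : Matrix (Fin 2) (Fin 2) (v.adicCompletion ℚ)) i j) =
      (((g⁻¹ : GL (Fin 2) (FiniteAdeleRing (𝓞 ℚ) ℚ)) : Matrix (Fin 2) (Fin 2) (FiniteAdeleRing (𝓞 ℚ) ℚ)) i j) v := by
    intro i j
    rw [← map_inv, ← map_inv, AdelicGroupData.coe_map_adeleEval_apply, GLn.coe_ofFinite_apply]
    rfl
  refine ⟨fun i j => ?_, fun i j => ?_, fun i j => ?_⟩
  · rw [e1]; exact (HeightOneSpectrum.mem_adicCompletionIntegers (R := 𝓞 ℚ) ℚ v).1 (hint i j v)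
  · rw [e2]; exact (HeightOneSpectrum.mem_adicCompletionIntegers (R := 𝓞 ℚ) ℚ v).1 (hint' i j v)
  · rw [Matrix.sub_apply, e1]
    have h := (mem_levelIdeal_iff.1 (hcong i j)) v
    have e : ((g : Matrix (Fin 2) (Fin 2) (FiniteAdeleRing (𝓞 ℚ) ℚ)) i j -
        (1 : Matrix (Fin 2) (Fin 2) (FiniteAdeleRing (𝓞 ℚ) ℚ)) i j) v =
        ((g : Matrix (Fin 2) (Fin 2) (FiniteAdeleRing (𝓞 ℚ) ℚ)) i j) v - (1 : Matrix (Fin 2) (Fin 2) (v.adicCompletion ℚ)) i j := by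
      rw [Matrix.one_apply, Matrix.one_apply]
      split_ifs <;> rfl
    rwa [e] at h

/-- The element `h_M = diag(M⁻¹, 1) ∈ GL₂(𝔸_ℚ^∞)` conjugating `K(M)` onto a group containing
`{u ∈ K₁(M²) | a ≡ 1 (M)}`. [folklore] -/
def Rat.levelRaisingElt (M : ℕ) [NeZero M] : GL (Fin 2) (FiniteAdeleRing (𝓞 ℚ) ℚ) :=
  glDiagonal 2 (FiniteAdeleRing (𝓞 ℚ) ℚ) ![(Rat.natUnitFinite M)⁻¹, 1]

/-- Entries of `h_M⁻¹ u h_M`: `(e_i)⁻¹ u_{ij} e_j` for `e = (M⁻¹, 1)`. [folklore] -/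
theorem Rat.levelRaisingElt_conj_apply (u : GL (Fin 2) (FiniteAdeleRing (𝓞 ℚ) ℚ)) (i j : Fin 2) :
    (((Rat.levelRaisingElt M)⁻¹ * u * Rat.levelRaisingElt M : GL (Fin 2) (FiniteAdeleRing (𝓞 ℚ) ℚ)) :
      Matrix (Fin 2) (Fin 2) (FiniteAdeleRing (𝓞 ℚ) ℚ)) i j =
      (((![(Rat.natUnitFinite M)⁻¹, 1] : Fin 2 → (FiniteAdeleRing (𝓞 ℚ) ℚ)ˣ) i)⁻¹ : (FiniteAdeleRing (𝓞 ℚ) ℚ)ˣ) *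
        (u : Matrix (Fin 2) (Fin 2) (FiniteAdeleRing (𝓞 ℚ) ℚ)) i j *
        ((![(Rat.natUnitFinite M)⁻¹, 1] : Fin 2 → (FiniteAdeleRing (𝓞 ℚ) ℚ)ˣ) j) := by
  rw [Rat.levelRaisingElt, ← map_inv, Units.val_mul, Units.val_mul, coe_glDiagonal, coe_glDiagonal,
    Matrix.mul_diagonal, Matrix.diagonal_mul, Pi.inv_apply]

/-- **The conjugate `h_M⁻¹ u h_M` lies in `K(M)`** for `u ∈ K₁(M²)` with upper left entry `≡ 1 (M)`:
its entries are `(a, M b; c/M, d)`. [folklore] -/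
theorem Rat.ofFinite_conj_levelRaisingElt_mem {u : GL (Fin 2) (FiniteAdeleRing (𝓞 ℚ) ℚ)}
    (hu : u ∈ gammaOneFiniteLevel ℚ (Ideal.span {((M ^ 2 : ℕ) : 𝓞 ℚ)}))
    (ha : (u : Matrix (Fin 2) (Fin 2) (FiniteAdeleRing (𝓞 ℚ) ℚ)) 0 0 - 1 ∈ levelIdeal ℚ (Ideal.span {(M : 𝓞 ℚ)})) :
    GLn.ofFinite 2 ℚ ((Rat.levelRaisingElt M)⁻¹ * u * Rat.levelRaisingElt M) ∈
      principalCongruenceLevel 2 ℚ (Ideal.span {(M : 𝓞 ℚ)}) := by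
  rw [mem_gammaOneFiniteLevel_iff, mem_gammaZeroFiniteLevel_iff, mem_eichlerOrder_iff, mem_eichlerOrder_iff] at hu
  obtain ⟨⟨⟨hint, hc⟩, hint', hc'⟩, hd⟩ := hu
  have hMi := Rat.natUnitFinite_mem_integralFiniteAdeles (M := M)
  -- entries of the conjugate and of its inverse
  have e := Rat.levelRaisingElt_conj_apply (M := M) u
  have e' := Rat.levelRaisingElt_conj_apply (M := M) u⁻¹
  have hinv : ((Rat.levelRaisingElt M)⁻¹ * u * Rat.levelRaisingElt M)⁻¹ =
      (Rat.levelRaisingElt M)⁻¹ * u⁻¹ * Rat.levelRaisingElt M := by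
    rw [mul_inv_rev, mul_inv_rev, inv_inv, mul_assoc]
  have v0 : ((![(Rat.natUnitFinite M)⁻¹, 1] : Fin 2 → (FiniteAdeleRing (𝓞 ℚ) ℚ)ˣ) 0) = (Rat.natUnitFinite M)⁻¹ := rfl
  have v1 : ((![(Rat.natUnitFinite M)⁻¹, 1] : Fin 2 → (FiniteAdeleRing (𝓞 ℚ) ℚ)ˣ) 1) = 1 := rfl
  -- the four entries, for `u` and `u⁻¹`
  have h00 : ∀ w : GL (Fin 2) (FiniteAdeleRing (𝓞 ℚ) ℚ),
      (((Rat.levelRaisingElt M)⁻¹ * w * Rat.levelRaisingElt M : GL (Fin 2) (FiniteAdeleRing (𝓞 ℚ) ℚ)) :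
        Matrix (Fin 2) (Fin 2) (FiniteAdeleRing (𝓞 ℚ) ℚ)) 0 0 = (w : Matrix (Fin 2) (Fin 2) (FiniteAdeleRing (𝓞 ℚ) ℚ)) 0 0 := by
    intro w
    rw [Rat.levelRaisingElt_conj_apply, v0, inv_inv, mul_comm, ← mul_assoc, Units.inv_mul, one_mul]
  have h01 : ∀ w : GL (Fin 2) (FiniteAdeleRing (𝓞 ℚ) ℚ),
      (((Rat.levelRaisingElt M)⁻¹ * w * Rat.levelRaisingElt M : GL (Fin 2) (FiniteAdeleRing (𝓞 ℚ) ℚ)) :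
        Matrix (Fin 2) (Fin 2) (FiniteAdeleRing (𝓞 ℚ) ℚ)) 0 1 =
        (Rat.natUnitFinite M : FiniteAdeleRing (𝓞 ℚ) ℚ) * (w : Matrix (Fin 2) (Fin 2) (FiniteAdeleRing (𝓞 ℚ) ℚ)) 0 1 := by
    intro w
    rw [Rat.levelRaisingElt_conj_apply, v0, v1, inv_inv, Units.val_one, mul_one]
  have h10 : ∀ w : GL (Fin 2) (FiniteAdeleRing (𝓞 ℚ) ℚ),
      (((Rat.levelRaisingElt M)⁻¹ * w * Rat.levelRaisingElt M : GL (Fin 2) (FiniteAdeleRing (𝓞 ℚ) ℚ)) :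
        Matrix (Fin 2) (Fin 2) (FiniteAdeleRing (𝓞 ℚ) ℚ)) 1 0 =
        (w : Matrix (Fin 2) (Fin 2) (FiniteAdeleRing (𝓞 ℚ) ℚ)) 1 0 * (((Rat.natUnitFinite M)⁻¹ : (FiniteAdeleRing (𝓞 ℚ) ℚ)ˣ) : FiniteAdeleRing (𝓞 ℚ) ℚ) := by
    intro w
    rw [Rat.levelRaisingElt_conj_apply, v0, v1, inv_one, Units.val_one, one_mul]
  have h11 : ∀ w : GL (Fin 2) (FiniteAdeleRing (𝓞 ℚ) ℚ),
      (((Rat.levelRaisingElt M)⁻¹ * w * Rat.levelRaisingElt M : GL (Fin 2) (FiniteAdeleRing (𝓞 ℚ) ℚ)) :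
        Matrix (Fin 2) (Fin 2) (FiniteAdeleRing (𝓞 ℚ) ℚ)) 1 1 = (w : Matrix (Fin 2) (Fin 2) (FiniteAdeleRing (𝓞 ℚ) ℚ)) 1 1 := by
    intro w
    rw [Rat.levelRaisingElt_conj_apply, v1, inv_one, Units.val_one, one_mul, mul_one]
  have hlev : ∀ {w : GL (Fin 2) (FiniteAdeleRing (𝓞 ℚ) ℚ)},
      (∀ i j, (w : Matrix (Fin 2) (Fin 2) (FiniteAdeleRing (𝓞 ℚ) ℚ)) i j ∈ integralFiniteAdeles ℚ) →
      (w : Matrix (Fin 2) (Fin 2) (FiniteAdeleRing (𝓞 ℚ) ℚ)) 1 0 ∈ levelIdeal ℚ (Ideal.span {((M ^ 2 : ℕ) : 𝓞 ℚ)}) →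
      ∀ i j, (((Rat.levelRaisingElt M)⁻¹ * w * Rat.levelRaisingElt M : GL (Fin 2) (FiniteAdeleRing (𝓞 ℚ) ℚ)) :
        Matrix (Fin 2) (Fin 2) (FiniteAdeleRing (𝓞 ℚ) ℚ)) i j ∈ integralFiniteAdeles ℚ := by
    intro w hw hwc i j
    fin_cases i <;> fin_cases j
    · simp only [Fin.zero_eta, Fin.isValue]; rw [h00]; exact hw 0 0
    · simp only [Fin.zero_eta, Fin.mk_one, Fin.isValue]; rw [h01]; exact mul_mem hMi (hw 0 1)
    · simp only [Fin.zero_eta, Fin.mk_one, Fin.isValue]; rw [h10]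
      exact mem_integralFiniteAdeles_of_mem_levelIdeal (Rat.mul_natUnitFinite_inv_mem_levelIdeal hwc)
    · simp only [Fin.mk_one, Fin.isValue]; rw [h11]; exact hw 1 1
  refine Rat.ofFinite_mem_principalCongruenceLevel (hlev hint hc) ?_ fun i j => ?_
  · rw [hinv]; exact hlev hint' hc'
  · fin_cases i <;> fin_cases j
    · simp only [Fin.zero_eta, Fin.isValue]; rw [h00, Matrix.one_apply_eq]; exact ha
    · simp only [Fin.zero_eta, Fin.mk_one, Fin.isValue]
      rw [h01, Matrix.one_apply_ne (by decide), sub_zero]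
      exact mul_mem_levelIdeal' Rat.natUnitFinite_mem_levelIdeal (hint 0 1)
    · simp only [Fin.zero_eta, Fin.mk_one, Fin.isValue]
      rw [h10, Matrix.one_apply_ne (by decide), sub_zero]
      exact Rat.mul_natUnitFinite_inv_mem_levelIdeal hc
    · simp only [Fin.mk_one, Fin.isValue]; rw [h11, Matrix.one_apply_eq]; exact Rat.levelIdeal_sq_le hd

/-- **`a ≡ det u (mod M)` on `K₁(M²)`**: for `u = (a b; c d) ∈ K₁(M²)`, `a - 1 ∈ M ẑ` as soon as
`det u - 1 ∈ M ẑ` (`a - 1 = (det u - 1) + b c - a (d - 1)`). [folklore] -/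
theorem Rat.entry_sub_one_mem_levelIdeal_of_det {u : GL (Fin 2) (FiniteAdeleRing (𝓞 ℚ) ℚ)}
    (hu : u ∈ gammaOneFiniteLevel ℚ (Ideal.span {((M ^ 2 : ℕ) : 𝓞 ℚ)}))
    (hdet : ((Matrix.GeneralLinearGroup.det u : (FiniteAdeleRing (𝓞 ℚ) ℚ)ˣ) : FiniteAdeleRing (𝓞 ℚ) ℚ) - 1 ∈
      levelIdeal ℚ (Ideal.span {(M : 𝓞 ℚ)})) :
    (u : Matrix (Fin 2) (Fin 2) (FiniteAdeleRing (𝓞 ℚ) ℚ)) 0 0 - 1 ∈ levelIdeal ℚ (Ideal.span {(M : 𝓞 ℚ)}) := by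
  rw [mem_gammaOneFiniteLevel_iff, mem_gammaZeroFiniteLevel_iff, mem_eichlerOrder_iff] at hu
  obtain ⟨⟨⟨hint, hc⟩, -⟩, hd⟩ := hu
  rw [Matrix.GeneralLinearGroup.val_det_apply, Matrix.det_fin_two] at hdet
  set a := (u : Matrix (Fin 2) (Fin 2) (FiniteAdeleRing (𝓞 ℚ) ℚ)) 0 0
  set b := (u : Matrix (Fin 2) (Fin 2) (FiniteAdeleRing (𝓞 ℚ) ℚ)) 0 1
  set c := (u : Matrix (Fin 2) (Fin 2) (FiniteAdeleRing (𝓞 ℚ) ℚ)) 1 0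
  set d := (u : Matrix (Fin 2) (Fin 2) (FiniteAdeleRing (𝓞 ℚ) ℚ)) 1 1
  have e : a - 1 = (a * d - b * c - 1) + b * c - a * (d - 1) := by ring
  rw [e]
  exact sub_mem (add_mem hdet (mul_mem_levelIdeal (hint 0 1) (Rat.levelIdeal_sq_le hc)))
    (mul_mem_levelIdeal (hint 0 0) (Rat.levelIdeal_sq_le hd))

/-- The finite part of `det (1, g)` is `det g`. [folklore] -/
theorem Rat.det_ofFinite_snd (g : GL (Fin 2) (FiniteAdeleRing (𝓞 ℚ) ℚ)) :
    ((Matrix.GeneralLinearGroup.det (GLn.ofFinite 2 ℚ g) : ideleGroup ℚ) : AdeleRing (𝓞 ℚ) ℚ).2 =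
      ((Matrix.GeneralLinearGroup.det g : (FiniteAdeleRing (𝓞 ℚ) ℚ)ˣ) : FiniteAdeleRing (𝓞 ℚ) ℚ) := by
  have h2 : (RingHom.snd (InfiniteAdeleRing ℚ) (FiniteAdeleRing (𝓞 ℚ) ℚ)).mapMatrix
      ((GLn.ofFinite 2 ℚ g : GL (Fin 2) (AdeleRing (𝓞 ℚ) ℚ)) : Matrix (Fin 2) (Fin 2) (AdeleRing (𝓞 ℚ) ℚ)) =
      ((g : GL (Fin 2) (FiniteAdeleRing (𝓞 ℚ) ℚ)) : Matrix (Fin 2) (Fin 2) (FiniteAdeleRing (𝓞 ℚ) ℚ)) := by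
    ext i j
    rw [RingHom.mapMatrix_apply, Matrix.map_apply, GLn.coe_ofFinite_apply]
    rfl
  have h := RingHom.map_det (RingHom.snd (InfiniteAdeleRing ℚ) (FiniteAdeleRing (𝓞 ℚ) ℚ))
    ((GLn.ofFinite 2 ℚ g : GL (Fin 2) (AdeleRing (𝓞 ℚ) ℚ)) : Matrix (Fin 2) (Fin 2) (AdeleRing (𝓞 ℚ) ℚ))
  rw [h2] at h
  rw [Matrix.GeneralLinearGroup.val_det_apply, Matrix.GeneralLinearGroup.val_det_apply]
  exact h

/-- The archimedean part of `det (1, g)` is `1`. [folklore] -/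
theorem Rat.det_ofFinite_fst (g : GL (Fin 2) (FiniteAdeleRing (𝓞 ℚ) ℚ)) :
    ((Matrix.GeneralLinearGroup.det (GLn.ofFinite 2 ℚ g) : ideleGroup ℚ) : AdeleRing (𝓞 ℚ) ℚ).1 = 1 := by
  have h1 : (RingHom.fst (InfiniteAdeleRing ℚ) (FiniteAdeleRing (𝓞 ℚ) ℚ)).mapMatrix
      ((GLn.ofFinite 2 ℚ g : GL (Fin 2) (AdeleRing (𝓞 ℚ) ℚ)) : Matrix (Fin 2) (Fin 2) (AdeleRing (𝓞 ℚ) ℚ)) = 1 := by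
    ext i j
    rw [RingHom.mapMatrix_apply, Matrix.map_apply, GLn.coe_ofFinite_apply]
    rfl
  have h := RingHom.map_det (RingHom.fst (InfiniteAdeleRing ℚ) (FiniteAdeleRing (𝓞 ℚ) ℚ))
    ((GLn.ofFinite 2 ℚ g : GL (Fin 2) (AdeleRing (𝓞 ℚ) ℚ)) : Matrix (Fin 2) (Fin 2) (AdeleRing (𝓞 ℚ) ℚ))
  rw [h1, Matrix.det_one] at h
  rw [Matrix.GeneralLinearGroup.val_det_apply]
  exact h

/-- `det (1, g)` has positive real component (`= 1`). [folklore] -/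
theorem Rat.infReal_det_ofFinite_pos (g : GL (Fin 2) (FiniteAdeleRing (𝓞 ℚ) ℚ)) :
    0 < Rat.infReal (Matrix.GeneralLinearGroup.det (GLn.ofFinite 2 ℚ g)) := by
  rw [Rat.infReal_apply, Rat.det_ofFinite_fst]
  change 0 < Rat.completionRealEquiv Rat.infinitePlace 1
  rw [map_one]; exact one_pos

/-- **`det u ∈ ẑˣ` for `u ∈ GL₂(ẑ)`**: every finite component of `det (1, u)` is a unit. [folklore] -/
theorem Rat.valued_det_ofFinite_eq_one {u : GL (Fin 2) (FiniteAdeleRing (𝓞 ℚ) ℚ)} (hu : u ∈ glFiniteIntegralLevel 2 ℚ)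
    (v : HeightOneSpectrum (𝓞 ℚ)) :
    Valued.v (((Matrix.GeneralLinearGroup.det (GLn.ofFinite 2 ℚ u) : ideleGroup ℚ) : AdeleRing (𝓞 ℚ) ℚ).2 v) = 1 := by
  rw [mem_glFiniteIntegralLevel_iff] at hu
  obtain ⟨hint, hint'⟩ := hu
  have hdi : ∀ {w : GL (Fin 2) (FiniteAdeleRing (𝓞 ℚ) ℚ)},
      (∀ i j, (w : Matrix (Fin 2) (Fin 2) (FiniteAdeleRing (𝓞 ℚ) ℚ)) i j ∈ integralFiniteAdeles ℚ) →
      Valued.v (((Matrix.GeneralLinearGroup.det w : (FiniteAdeleRing (𝓞 ℚ) ℚ)ˣ) : FiniteAdeleRing (𝓞 ℚ) ℚ) v) ≤ 1 := by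
    intro w hw
    have hmem : ((Matrix.GeneralLinearGroup.det w : (FiniteAdeleRing (𝓞 ℚ) ℚ)ˣ) : FiniteAdeleRing (𝓞 ℚ) ℚ) ∈ integralFiniteAdeles ℚ := by
      rw [Matrix.GeneralLinearGroup.val_det_apply, Matrix.det_fin_two]
      exact sub_mem (mul_mem (hw 0 0) (hw 1 1)) (mul_mem (hw 0 1) (hw 1 0))
    exact (HeightOneSpectrum.mem_adicCompletionIntegers (R := 𝓞 ℚ) ℚ v).1 (hmem v)
  have h1 := hdi hint
  have h2 := hdi hint'
  have hprod : Valued.v (((Matrix.GeneralLinearGroup.det u : (FiniteAdeleRing (𝓞 ℚ) ℚ)ˣ) : FiniteAdeleRing (𝓞 ℚ) ℚ) v) *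
      Valued.v (((Matrix.GeneralLinearGroup.det u⁻¹ : (FiniteAdeleRing (𝓞 ℚ) ℚ)ˣ) : FiniteAdeleRing (𝓞 ℚ) ℚ) v) = 1 := by
    rw [← map_mul, ← FiniteAdeleRing.mul_apply', ← Units.val_mul, ← map_mul, mul_inv_cancel, map_one, Units.val_one]
    change Valued.v (1 : v.adicCompletion ℚ) = 1
    exact map_one _
  rw [Rat.det_ofFinite_snd]
  refine le_antisymm h1 ?_
  calc (1 : WithZero (Multiplicative ℤ)) = _ := hprod.symm
    _ ≤ Valued.v (((Matrix.GeneralLinearGroup.det u : (FiniteAdeleRing (𝓞 ℚ) ℚ)ˣ) : FiniteAdeleRing (𝓞 ℚ) ℚ) v) * 1 :=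
        mul_le_mul' le_rfl h2
    _ = _ := mul_one _

/-- **From the ray class of `det u` to the congruence on `a`**: for `u ∈ K₁(M²)` with
`rayClassHom M (det (1, u)) = 1`, the upper left entry of `u` is `≡ 1 (mod M)`. [folklore] -/
theorem Rat.entry_sub_one_mem_levelIdeal_of_rayClassHom_eq_one {u : GL (Fin 2) (FiniteAdeleRing (𝓞 ℚ) ℚ)}
    (hu : u ∈ gammaOneFiniteLevel ℚ (Ideal.span {((M ^ 2 : ℕ) : 𝓞 ℚ)}))
    (h : Rat.rayClassHom M (Matrix.GeneralLinearGroup.det (GLn.ofFinite 2 ℚ u)) = 1) :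
    (u : Matrix (Fin 2) (Fin 2) (FiniteAdeleRing (𝓞 ℚ) ℚ)) 0 0 - 1 ∈ levelIdeal ℚ (Ideal.span {(M : 𝓞 ℚ)}) := by
  have hint : u ∈ glFiniteIntegralLevel 2 ℚ :=
    gammaZeroFiniteLevel_le_glFiniteIntegralLevel _ (gammaOneFiniteLevel_le_gammaZeroFiniteLevel _ hu)
  have hunit := Rat.valued_det_ofFinite_eq_one hint
  rw [Rat.rayClassHom_eq_redMod M _ (Rat.infReal_det_ofFinite_pos u) hunit] at h
  have hlev := Rat.sub_one_mem_levelIdeal_of_redMod_eq_one hunit h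
  rw [Rat.det_ofFinite_snd] at hlev
  exact Rat.entry_sub_one_mem_levelIdeal_of_det hu hlev

end FiniteLevel

/-! ### Finite Fourier analysis: isotypic components for an action through `(ℤ/m)ˣ` -/

section CharComponent

variable {G : Type*} [Group G] {V : Type*} [AddCommGroup V] [Module ℂ V]
  (ρ : Representation ℂ G V) {m : ℕ} [NeZero m] (r : G →* (ZMod m)ˣ)

/-- A set-theoretic section of `r : G → (ℤ/m)ˣ` over its range (junk value `1` off the range). [folklore] -/
def rangeSection (a : (ZMod m)ˣ) : G := if h : a ∈ r.range then h.choose else 1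

omit [NeZero m] in
/-- `r (rangeSection r a) = a` on the range. [folklore] -/
theorem apply_rangeSection {a : (ZMod m)ˣ} (ha : a ∈ r.range) : r (rangeSection r a) = a := by
  unfold rangeSection; rw [dif_pos ha]; exact ha.choose_spec

/-- **The `χ`-component** (up to the factor `φ(m)`) of a vector `v` for a linear action `ρ` of `G`
through `r : G → (ℤ/m)ˣ`: `v_χ = ∑_{a ∈ r(G)} χ(a)⁻¹ ρ(s(a)) v` for a section `s` of `r` (finite
Fourier inversion on the abelian group `(ℤ/m)ˣ`). [folklore] -/
def charComponent (χ : DirichletCharacter ℂ m) (v : V) : V :=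
  ∑ a : (ZMod m)ˣ, if a ∈ r.range then χ ((a⁻¹ : (ZMod m)ˣ) : ZMod m) • ρ (rangeSection r a) v else 0

/-- The components lie in any `ρ`-stable subspace containing `v`. [folklore] -/
theorem charComponent_mem {W : Submodule ℂ V} (hW : ∀ g : G, ∀ w ∈ W, ρ g w ∈ W) (χ : DirichletCharacter ℂ m)
    {v : V} (hv : v ∈ W) : charComponent ρ r χ v ∈ W := by
  unfold charComponent
  refine Submodule.sum_mem _ fun a _ => ?_
  split_ifs
  · exact W.smul_mem _ (hW _ _ hv)
  · exact W.zero_mem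

omit [NeZero m] in
/-- `χ(u) χ(u⁻¹) = 1` on units. [folklore] -/
theorem DirichletCharacter.apply_mul_apply_inv (χ : DirichletCharacter ℂ m) (u : (ZMod m)ˣ) :
    χ (u : ZMod m) * χ ((u⁻¹ : (ZMod m)ˣ) : ZMod m) = 1 := by
  rw [← map_mul, ← Units.val_mul, mul_inv_cancel, Units.val_one, map_one]

/-- **Equivariance of the `χ`-component**: if the kernel of `r` fixes `v`, then
`ρ(g) v_χ = χ(r g) v_χ` for every `g ∈ G`. [folklore] -/
theorem apply_charComponent (χ : DirichletCharacter ℂ m) {v : V} (hv : ∀ k : G, r k = 1 → ρ k v = v) (g : G) :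
    ρ g (charComponent ρ r χ v) = χ ((r g : (ZMod m)ˣ) : ZMod m) • charComponent ρ r χ v := by
  have hg : r g ∈ r.range := ⟨g, rfl⟩
  -- `ρ(g s(a)) v = ρ(s(r(g) a)) v`
  have key : ∀ a ∈ r.range, ρ (g * rangeSection r a) v = ρ (rangeSection r (r g * a)) v := by
    intro a ha
    have hga : r g * a ∈ r.range := mul_mem hg ha
    set k := (rangeSection r (r g * a))⁻¹ * (g * rangeSection r a) with hk
    have hrk : r k = 1 := by
      rw [hk, map_mul, map_inv, map_mul, apply_rangeSection r hga, apply_rangeSection r ha, inv_mul_cancel]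
    have e : g * rangeSection r a = rangeSection r (r g * a) * k := by rw [hk, mul_inv_cancel_left]
    rw [e, map_mul, Module.End.mul_apply, hv k hrk]
  unfold charComponent
  rw [map_sum, Finset.smul_sum]
  refine Fintype.sum_equiv (Equiv.mulLeft (r g)) _ _ fun a => ?_
  simp only [Equiv.coe_mulLeft]
  by_cases ha : a ∈ r.range
  · have hga : r g * a ∈ r.range := mul_mem hg ha
    rw [if_pos ha, if_pos hga, map_smul, ← Module.End.mul_apply, ← map_mul, key a ha, smul_smul, mul_inv_rev,
      Units.val_mul, map_mul, mul_left_comm, DirichletCharacter.apply_mul_apply_inv, mul_one]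
  · have hga : r g * a ∉ r.range := fun h => ha (by simpa using mul_mem (inv_mem hg) h)
    rw [if_neg ha, if_neg hga, map_zero, smul_zero]

/-- **Fourier inversion**: `∑_χ v_χ = φ(m) v` if the kernel of `r` fixes `v`. [folklore] -/
theorem sum_charComponent {v : V} (hv : ∀ k : G, r k = 1 → ρ k v = v) :
    ∑ χ : DirichletCharacter ℂ m, charComponent ρ r χ v = (m.totient : ℂ) • v := by
  unfold charComponent
  rw [Finset.sum_comm]
  have h1 : ∀ a : (ZMod m)ˣ, (∑ χ : DirichletCharacter ℂ m,
      (if a ∈ r.range then χ ((a⁻¹ : (ZMod m)ˣ) : ZMod m) • ρ (rangeSection r a) v else 0)) =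
      if a ∈ r.range then (∑ χ : DirichletCharacter ℂ m, χ ((a⁻¹ : (ZMod m)ˣ) : ZMod m)) • ρ (rangeSection r a) v else 0 := by
    intro a
    split_ifs
    · rw [Finset.sum_smul]
    · rw [Finset.sum_const_zero]
  simp_rw [h1, DirichletCharacter.sum_characters_eq, Units.val_eq_one, inv_eq_one]
  rw [Finset.sum_eq_single (1 : (ZMod m)ˣ)]
  · rw [if_pos (one_mem _), if_pos rfl, hv _ (apply_rangeSection r (one_mem _))]
  · intro a _ ha
    rw [if_neg ha, zero_smul, ite_self]
  · intro h; exact absurd (Finset.mem_univ _) h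

/-- **Some `χ`-component of a non-zero vector is non-zero** (if the kernel of `r` fixes it). [folklore] -/
theorem exists_charComponent_ne_zero {v : V} (hv : ∀ k : G, r k = 1 → ρ k v = v) (hv0 : v ≠ 0) :
    ∃ χ : DirichletCharacter ℂ m, charComponent ρ r χ v ≠ 0 := by
  by_contra h
  push Not at h
  have hs := sum_charComponent ρ r hv
  rw [Finset.sum_eq_zero (fun χ _ => h χ)] at hs
  have hφ : (m.totient : ℂ) ≠ 0 := by exact_mod_cast (Nat.totient_pos.2 (NeZero.pos m)).ne'
  exact hv0 ((smul_eq_zero.1 hs.symm).resolve_left hφ)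

end CharComponent

/-! ### `{1} × K₁(M)`-invariant functions and the action of `K₁(L)` -/

section Invariants

/-- The space of functions on `GL₂(𝔸_ℚ)` right invariant under `{1} × K₁(M)`. [folklore] -/
def gammaOneFiniteInvariants (M : ℕ) : Submodule ℂ ((AdelicGroupData.gl 2 ℚ).Adelic → ℂ) where
  carrier := {φ | ∀ h ∈ gammaOneFiniteLevel ℚ (Ideal.span {(M : 𝓞 ℚ)}),
    ∀ g : GL (Fin 2) (AdeleRing (𝓞 ℚ) ℚ), φ (g * GLn.ofFinite 2 ℚ h) = φ g}
  zero_mem' := fun _ _ _ => rfl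
  add_mem' := fun ha hb h hh g => by simp only [Pi.add_apply, ha h hh g, hb h hh g]
  smul_mem' := fun c _ ha h hh g => by simp only [Pi.smul_apply, ha h hh g]

variable {M : ℕ}

/-- Membership in `gammaOneFiniteInvariants M`. [folklore] -/
theorem mem_gammaOneFiniteInvariants {φ : (AdelicGroupData.gl 2 ℚ).Adelic → ℂ} :
    φ ∈ gammaOneFiniteInvariants M ↔ ∀ h ∈ gammaOneFiniteLevel ℚ (Ideal.span {(M : 𝓞 ℚ)}),
      ∀ g : GL (Fin 2) (AdeleRing (𝓞 ℚ) ℚ), φ (g * GLn.ofFinite 2 ℚ h) = φ g := Iff.rfl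

/-- Membership in `gammaOneFiniteInvariants M` through right translations. [folklore] -/
theorem mem_gammaOneFiniteInvariants_iff_rightTranslation {φ : (AdelicGroupData.gl 2 ℚ).Adelic → ℂ} :
    φ ∈ gammaOneFiniteInvariants M ↔ ∀ h ∈ gammaOneFiniteLevel ℚ (Ideal.span {(M : 𝓞 ℚ)}),
      rightTranslation (AdelicGroupData.gl 2 ℚ) (GLn.ofFinite 2 ℚ h) φ = φ := by
  refine forall_congr' fun h => forall_congr' fun _ => ⟨fun H => funext fun g => H g, fun H g => ?_⟩
  exact congrFun H g

/-- `K(M) ⊆ {1} × K₁(M)`: a `{1} × K₁(M)`-invariant function is fixed by `K(M)`. [folklore] -/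
theorem rightTranslation_eq_of_mem_gammaOneFiniteInvariants {φ : (AdelicGroupData.gl 2 ℚ).Adelic → ℂ}
    (hφ : φ ∈ gammaOneFiniteInvariants M) {u : (AdelicGroupData.gl 2 ℚ).Adelic}
    (hu : u ∈ principalCongruenceLevel 2 ℚ (Ideal.span {(M : 𝓞 ℚ)})) :
    rightTranslation (AdelicGroupData.gl 2 ℚ) u φ = φ := by
  funext g
  rw [rightTranslation_apply]
  have h' := hφ _ (Rat.sndHom_mem_gammaOneFiniteLevel_of_mem_principalCongruenceLevel hu) g
  rwa [GLn.ofFinite_sndHom_of_mem (principalCongruenceLevel_le 2 ℚ _ hu)] at h'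

/-- Right translation restricted to `{1} × K₁(L)`, as a representation of `K₁(L)` on functions. [folklore] -/
def gammaOneRep (L : ℕ) :
    Representation ℂ (gammaOneFiniteLevel ℚ (Ideal.span {(L : 𝓞 ℚ)})) ((AdelicGroupData.gl 2 ℚ).Adelic → ℂ) :=
  (rightTranslation (AdelicGroupData.gl 2 ℚ)).comp ((GLn.ofFinite 2 ℚ).comp (Subgroup.subtype _))

/-- Unfolding `gammaOneRep`. [folklore] -/
theorem gammaOneRep_apply (L : ℕ) (k : gammaOneFiniteLevel ℚ (Ideal.span {(L : 𝓞 ℚ)}))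
    (φ : (AdelicGroupData.gl 2 ℚ).Adelic → ℂ) :
    gammaOneRep L k φ = rightTranslation (AdelicGroupData.gl 2 ℚ) (GLn.ofFinite 2 ℚ (k : GL (Fin 2) (FiniteAdeleRing (𝓞 ℚ) ℚ))) φ := rfl

/-- **The ray class mod `M` of the determinant**, `K₁(L) → (ℤ/M)ˣ`, `k ↦ [det (1, k)]`. [folklore] -/
def detRayClass (M L : ℕ) [NeZero M] : (gammaOneFiniteLevel ℚ (Ideal.span {(L : 𝓞 ℚ)})) →* (ZMod M)ˣ :=
  (Rat.rayClassHom M).comp ((Matrix.GeneralLinearGroup.det).comp ((GLn.ofFinite 2 ℚ).comp (Subgroup.subtype _)))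

/-- Unfolding `detRayClass`. [folklore] -/
theorem detRayClass_apply {M L : ℕ} [NeZero M] (k : gammaOneFiniteLevel ℚ (Ideal.span {(L : 𝓞 ℚ)})) :
    detRayClass M L k = Rat.rayClassHom M (Matrix.GeneralLinearGroup.det (GLn.ofFinite 2 ℚ (k : GL (Fin 2) (FiniteAdeleRing (𝓞 ℚ) ℚ)))) := rfl

end Invariants

/-! ### The new vector up to twist -/

section Main

variable {hcpt : isCompact_glFiniteIntegralLevel 2 ℚ} {M : ℕ} [NeZero M]

/-- **The translate `r(h_M) ψ` of a `K(M)`-fixed function is fixed by `{k ∈ K₁(M²) | det k ≡ 1 (M)}`**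
(the kernel of the ray class of the determinant): `k h_M = h_M (h_M⁻¹ k h_M)` with `h_M⁻¹ k h_M ∈ K(M)`.
[folklore] -/
theorem gammaOneRep_rightTranslation_levelRaisingElt {ψ : (AdelicGroupData.gl 2 ℚ).Adelic → ℂ}
    (hfix : ∀ u ∈ principalCongruenceLevel 2 ℚ (Ideal.span {(M : 𝓞 ℚ)}), rightTranslation (AdelicGroupData.gl 2 ℚ) u ψ = ψ)
    (k : gammaOneFiniteLevel ℚ (Ideal.span {((M ^ 2 : ℕ) : 𝓞 ℚ)})) (hk : detRayClass M (M ^ 2) k = 1) :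
    gammaOneRep (M ^ 2) k (rightTranslation (AdelicGroupData.gl 2 ℚ) (GLn.ofFinite 2 ℚ (Rat.levelRaisingElt M)) ψ) =
      rightTranslation (AdelicGroupData.gl 2 ℚ) (GLn.ofFinite 2 ℚ (Rat.levelRaisingElt M)) ψ := by
  have e : (k : GL (Fin 2) (FiniteAdeleRing (𝓞 ℚ) ℚ)) * Rat.levelRaisingElt M =
      Rat.levelRaisingElt M * ((Rat.levelRaisingElt M)⁻¹ * (k : GL (Fin 2) (FiniteAdeleRing (𝓞 ℚ) ℚ)) * Rat.levelRaisingElt M) := by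
    rw [mul_assoc, mul_inv_cancel_left]
  have e' : GLn.ofFinite 2 ℚ (k : GL (Fin 2) (FiniteAdeleRing (𝓞 ℚ) ℚ)) * GLn.ofFinite 2 ℚ (Rat.levelRaisingElt M) =
      GLn.ofFinite 2 ℚ (Rat.levelRaisingElt M) *
        GLn.ofFinite 2 ℚ ((Rat.levelRaisingElt M)⁻¹ * (k : GL (Fin 2) (FiniteAdeleRing (𝓞 ℚ) ℚ)) * Rat.levelRaisingElt M) := by
    rw [← map_mul, ← map_mul, ← e]
  have hmem := Rat.ofFinite_conj_levelRaisingElt_mem k.2 (Rat.entry_sub_one_mem_levelIdeal_of_rayClassHom_eq_one k.2 hk)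
  have aux : ∀ g : GL (Fin 2) (AdeleRing (𝓞 ℚ) ℚ),
      ψ (g * GLn.ofFinite 2 ℚ (k : GL (Fin 2) (FiniteAdeleRing (𝓞 ℚ) ℚ)) * GLn.ofFinite 2 ℚ (Rat.levelRaisingElt M)) =
        ψ (g * GLn.ofFinite 2 ℚ (Rat.levelRaisingElt M)) := by
    intro g
    have h1 := congrFun (hfix _ hmem) (g * GLn.ofFinite 2 ℚ (Rat.levelRaisingElt M))
    rw [rightTranslation_apply] at h1
    rw [mul_assoc, e', ← mul_assoc]
    exact h1
  funext g
  exact aux g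

/-- **A new vector up to twist** (elementary substitute for the existence of the new vector,
Casselman 1973, Thm. 1): let `π` be an automorphic representation of `GL₂(𝔸_ℚ)` (Borel–Jacquet datum)
and `ψ ∈ W` a non-zero `K(M)`-fixed form. Then for some Dirichlet character `χ` mod `M` the twist
`π ⊗ (χ̃ ∘ det)` (`χ̃` the Hecke character of `χ`) contains a non-zero form right invariant under
`{1} × K₁(M²)`: the translate `r(h_M) ψ`, `h_M = diag(M⁻¹, 1)_f`, is fixed by the kernel of
`k ↦ [det k] : K₁(M²) → (ℤ/M)ˣ`; one of its isotypic components `ψ_χ` under `K₁(M²)` is non-zero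
and transforms by `χ([det k])`, and `(χ̃ ∘ det) · ψ_χ` is `K₁(M²)`-invariant since
`χ̃(det (1, k)) = χ([det k])⁻¹`. [folklore] -/
theorem AutomorphicRepData.exists_twist_mem_gammaOneFiniteInvariants (π : AutomorphicRepData (AutomorphyDatum.gl 2 ℚ hcpt))
    {ψ : (AdelicGroupData.gl 2 ℚ).Adelic → ℂ} (hψW : ψ ∈ π.W) (hψ0 : ψ ≠ 0)
    (hfix : ∀ u ∈ principalCongruenceLevel 2 ℚ (Ideal.span {(M : 𝓞 ℚ)}), rightTranslation (AdelicGroupData.gl 2 ℚ) u ψ = ψ) :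
    ∃ χ : DirichletCharacter ℂ M,
      ∃ θ ∈ (π.twist (HeckeCharacter.ofDirichlet χ) (HeckeCharacter.isFiniteOrder_ofDirichlet χ)).W,
        θ ≠ 0 ∧ θ ∈ gammaOneFiniteInvariants (M ^ 2) := by
  set h := GLn.ofFinite 2 ℚ (Rat.levelRaisingElt M) with hh
  set ψ₁ := rightTranslation (AdelicGroupData.gl 2 ℚ) h ψ with hψ₁
  have hstab : ∀ (x : GL (Fin 2) (FiniteAdeleRing (𝓞 ℚ) ℚ)) (w : (AdelicGroupData.gl 2 ℚ).Adelic → ℂ), w ∈ π.W →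
      rightTranslation (AdelicGroupData.gl 2 ℚ) (GLn.ofFinite 2 ℚ x) w ∈ π.W :=
    fun x w hw => π.stable.finite_stable (GLn.ofFinite 2 ℚ x) ⟨x, rfl⟩ hw
  have hψ₁W : ψ₁ ∈ π.W := hstab _ _ hψW
  have hψ₁0 : ψ₁ ≠ 0 := by
    intro h0
    apply hψ0
    have e : rightTranslation (AdelicGroupData.gl 2 ℚ) h⁻¹ ψ₁ = ψ := by
      rw [hψ₁, ← Module.End.mul_apply, ← map_mul, inv_mul_cancel, map_one, Module.End.one_apply]
    rw [← e, h0, map_zero]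
  have hker : ∀ k : gammaOneFiniteLevel ℚ (Ideal.span {((M ^ 2 : ℕ) : 𝓞 ℚ)}), detRayClass M (M ^ 2) k = 1 →
      gammaOneRep (M ^ 2) k ψ₁ = ψ₁ := fun k hk => gammaOneRep_rightTranslation_levelRaisingElt hfix k hk
  obtain ⟨χ, hχ⟩ := exists_charComponent_ne_zero (gammaOneRep (M ^ 2)) (detRayClass M (M ^ 2)) hker hψ₁0
  set ψχ := charComponent (gammaOneRep (M ^ 2)) (detRayClass M (M ^ 2)) χ ψ₁ with hψχ
  have hψχW : ψχ ∈ π.W :=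
    charComponent_mem _ _ (fun k w hw => hstab _ _ hw) χ hψ₁W
  set c := detTwist 2 (HeckeCharacter.ofDirichlet χ) with hc
  refine ⟨χ, mulChar c ψχ, Submodule.mem_map_of_mem hψχW, fun h0 => hχ (mulChar_injective c (by rw [h0, map_zero])), ?_⟩
  rw [mem_gammaOneFiniteInvariants_iff_rightTranslation]
  intro k hk
  have hrt := rightTranslation_mulChar (AdelicGroupData.gl 2 ℚ) c (GLn.ofFinite 2 ℚ k) ψχ
  rw [hrt]
  have heq := apply_charComponent (gammaOneRep (M ^ 2)) (detRayClass M (M ^ 2)) χ hker ⟨k, hk⟩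
  rw [gammaOneRep_apply] at heq
  change rightTranslation (AdelicGroupData.gl 2 ℚ) (GLn.ofFinite 2 ℚ k) ψχ = _ at heq
  rw [heq, map_smul, smul_smul]
  have hcχ : (c (GLn.ofFinite 2 ℚ k) : ℂ) * χ ((detRayClass M (M ^ 2) ⟨k, hk⟩ : (ZMod M)ˣ) : ZMod M) = 1 := by
    rw [hc, detTwist_apply, HeckeCharacter.ofDirichlet_apply, ← MulChar.coe_toUnitHom, ← Units.val_mul,
      detRayClass_apply, inv_mul_cancel, Units.val_one]
  rw [hcχ, one_smul]

/-- **Every automorphic representation of `GL₂(𝔸_ℚ)` has a new vector up to twist**: there are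
`M ≥ 1`, a Dirichlet character `χ` mod `M` and a non-zero form of `π ⊗ (χ̃ ∘ det)` right invariant
under `{1} × K₁(M²)` (a level `K(𝔫)` of a form of `π`, `exists_principalCongruenceLevel_fixed`, contains
`K(M)` for `M = N(𝔫)`). [folklore] -/
theorem AutomorphicRepData.exists_level_twist_mem_gammaOneFiniteInvariants (π : AutomorphicRepData (AutomorphyDatum.gl 2 ℚ hcpt)) :
    ∃ (M : ℕ) (_ : NeZero M) (χ : DirichletCharacter ℂ M),
      ∃ θ ∈ (π.twist (HeckeCharacter.ofDirichlet χ) (HeckeCharacter.isFiniteOrder_ofDirichlet χ)).W,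
        θ ≠ 0 ∧ θ ∈ gammaOneFiniteInvariants (M ^ 2) := by
  obtain ⟨𝔫, h𝔫, φ, hφW, hφW', hfix⟩ := π.exists_principalCongruenceLevel_fixed
  set M := Ideal.absNorm 𝔫 with hM
  have hM0 : M ≠ 0 := fun h => h𝔫 (Ideal.absNorm_eq_zero_iff.1 h)
  haveI : NeZero M := ⟨hM0⟩
  have hle : Ideal.span {(M : 𝓞 ℚ)} ≤ 𝔫 := by
    rw [Ideal.span_singleton_le_iff_mem]; exact Ideal.absNorm_mem 𝔫
  have hfix' : ∀ u ∈ principalCongruenceLevel 2 ℚ (Ideal.span {(M : 𝓞 ℚ)}), rightTranslation (AdelicGroupData.gl 2 ℚ) u φ = φ :=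
    fun u hu => hfix u (principalCongruenceLevel_mono 2 ℚ (Rat.span_natCast_ne_zero M) hle hu)
  have hφ0 : φ ≠ 0 := fun h => hφW' (h ▸ π.W'.zero_mem)
  obtain ⟨χ, θ, hθW, hθ0, hθK⟩ := π.exists_twist_mem_gammaOneFiniteInvariants hφW hφ0 hfix'
  exact ⟨M, inferInstance, χ, θ, hθW, hθ0, hθK⟩

end Main

end Literature.NumberTheory.Automorphic

end
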